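import Mathlib
import Literature.Geometry.Riemannian.RicciFlowMaximal
import Literature.Geometry.Riemannian.CurvatureFamilyBounds
import HarnessLib

/-!
# Candidate proof of the registered stub `stub_pointPicking`
(line `ancient-sphere-rigidity`, lead reshape r2, crux stmt-SmoothPoincare4-10869).

Statement verbatim from `Lines/ancient-sphere-rigidity.lean`. Fact-free proof (refuter-drefute,
2026-08-15): `K₀` = a curvature bound on `M × [0, T/2]` (`IsRicciFlow.exists_curvatureBoundedBy_Icc`);
the blow-up clause with `C := max (2 K₁) (4k/T) + 1`, `K₁ := max K₀ 0`, gives a time `t' ∈ [T/2, T)`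
at which `|Rm| > C` on some unit-bounded quadruple; `Q :=` the supremum of `|Rm|` over unit-bounded
quadruples on `M × [0, t']` (finite by `exists_curvatureBoundedBy_Icc` again); a quadruple with value
`> Q/2` exists (`Q > C > 0`), its time `s` exceeds `T/2` (value `> Q/2 > C/2 > K₁ ≥ K₀`), and
`Q s > (4k/T)(T/2) = 2k ≥ k`.
-/

open scoped Manifold ContDiff Topology
open Set Function
open Literature.Geometry.Lorentzian Literature.Geometry.Riemannian

namespace Summit.SmoothPoincare4.SmoothPoincare4.Cruxes.SubcylindricalRecognition.AncientSphereRigidity.Refuter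

/-- **Point picking** (Hamilton 1995; Topping 2006 §7.3), sorry-free proof of the registered stub
`stub_pointPicking` (type verbatim). [folklore] -/
theorem stub_pointPicking_proof :
    ∀ (M : Type) [TopologicalSpace M] [T2Space M] [SecondCountableTopology M]
      [ChartedSpace (EuclideanSpace ℝ (Fin 4)) M] [IsManifold (𝓡 4) ∞ M] [CompactSpace M]
      [ConnectedSpace M] [T3Space M] [MeasurableSpace M] [BorelSpace M] (T : ℝ)
      (g : ℝ → PseudoRiemannianMetric (𝓡 4) ∞ (EuclideanSpace ℝ (Fin 4)) (TangentSpace (𝓡 4) : M → Type _))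
      (cov : ℝ → CovariantDerivative (𝓡 4) (EuclideanSpace ℝ (Fin 4)) (TangentSpace (𝓡 4) : M → Type _)),
      IsMaximalRicciFlow g cov T →
      (∀ C : ℝ, ∃ t₀ ∈ Set.Ico 0 T, ∀ t ∈ Set.Ico t₀ T, ¬ CurvatureBoundedBy (g t) (cov t) C) →
      ∃ (tk Qk : ℕ → ℝ) (xk : ℕ → M),
        (∀ k, tk k ∈ Set.Ico 0 T) ∧ (∀ k, 0 < Qk k) ∧ (∀ k : ℕ, (k : ℝ) ≤ Qk k * tk k) ∧
        (∀ k, ∀ t ∈ Set.Icc 0 (tk k), CurvatureBoundedBy (g t) (cov t) (Qk k)) ∧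
        (∀ k, ∃ X Y Z W : TangentSpace (𝓡 4) (xk k),
          (g (tk k)).val (xk k) X X ≤ 1 ∧ (g (tk k)).val (xk k) Y Y ≤ 1 ∧
          (g (tk k)).val (xk k) Z Z ≤ 1 ∧ (g (tk k)).val (xk k) W W ≤ 1 ∧
          Qk k / 2 ≤ |(g (tk k)).curvatureForm (cov (tk k)) (xk k) X Y Z W|) := by
  intro M _ _ _ _ _ _ _ _ _ _ T g cov hmax hblow
  -- it suffices to pick, for each `k`, one triple `(t, Q, x)` with the five properties
  suffices h : ∀ k : ℕ, ∃ (t Q : ℝ) (x : M), t ∈ Set.Ico 0 T ∧ 0 < Q ∧ (k : ℝ) ≤ Q * t ∧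
      (∀ s ∈ Set.Icc 0 t, CurvatureBoundedBy (g s) (cov s) Q) ∧
      ∃ X Y Z W : TangentSpace (𝓡 4) x,
        (g t).val x X X ≤ 1 ∧ (g t).val x Y Y ≤ 1 ∧ (g t).val x Z Z ≤ 1 ∧ (g t).val x W W ≤ 1 ∧
        Q / 2 ≤ |(g t).curvatureForm (cov t) x X Y Z W| by
    choose tk Qk xk h1 h2 h3 h4 h5 using h
    exact ⟨tk, Qk, xk, h1, h2, h3, h4, h5⟩
  intro k
  have hT : 0 < T := hmax.pos
  have hflow := hmax.isRicciFlow
  have hRiem := hmax.isRiemannian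
  -- `K₀`: a curvature bound on `[0, T/2]`
  obtain ⟨K₀, hK₀⟩ := hflow.exists_curvatureBoundedBy_Icc hRiem (t₁ := T / 2) (by linarith)
  set K₁ : ℝ := max K₀ 0 with hK₁
  have hK₁0 : 0 ≤ K₁ := le_max_right _ _
  have hK₀K₁ : K₀ ≤ K₁ := le_max_left _ _
  -- the level `C`
  set C : ℝ := max (2 * K₁) (4 * k / T) + 1 with hC
  have hC1 : 2 * K₁ < C := by
    have := le_max_left (2 * K₁) (4 * k / T); linarith
  have hC2 : 4 * k / T < C := by
    have := le_max_right (2 * K₁) (4 * k / T); linarith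
  have hC0 : 0 < C := by linarith
  -- a time `t' ∈ [T/2, T)` where the bound `C` is violated
  obtain ⟨t₀, ht₀, hviol⟩ := hblow C
  set t' : ℝ := max t₀ (T / 2) with ht'
  have ht'T : t' < T := max_lt ht₀.2 (by linarith)
  have ht'0 : 0 ≤ t' := le_trans ht₀.1 (le_max_left _ _)
  have ht'half : T / 2 ≤ t' := le_max_right _ _
  have hv : ¬ CurvatureBoundedBy (g t') (cov t') C := hviol t' ⟨le_max_left _ _, ht'T⟩
  -- a bound `K` on `[0, t']`
  obtain ⟨K, hK⟩ := hflow.exists_curvatureBoundedBy_Icc hRiem (t₁ := t') ht'T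
  -- the set of curvature values on unit-bounded quadruples over `M × [0, t']`
  set V : Set ℝ := {v | ∃ s ∈ Set.Icc 0 t', ∃ (x : M) (X Y Z W : TangentSpace (𝓡 4) x),
      (g s).val x X X ≤ 1 ∧ (g s).val x Y Y ≤ 1 ∧ (g s).val x Z Z ≤ 1 ∧ (g s).val x W W ≤ 1 ∧
      v = |(g s).curvatureForm (cov s) x X Y Z W|} with hV
  have hVbdd : BddAbove V := by
    refine ⟨K, ?_⟩
    rintro v ⟨s, hs, x, X, Y, Z, W, hX, hY, hZ, hW, rfl⟩
    exact hK s hs x X Y Z W hX hY hZ hW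
  -- from the violation at `t'`: a value `> C` in `V`
  have hbig : ∃ v ∈ V, C < v := by
    unfold CurvatureBoundedBy at hv
    push Not at hv
    obtain ⟨x, X, Y, Z, W, hX, hY, hZ, hW, hlt⟩ := hv
    exact ⟨_, ⟨t', ⟨ht'0, le_rfl⟩, x, X, Y, Z, W, hX, hY, hZ, hW, rfl⟩, hlt⟩
  obtain ⟨v₀, hv₀V, hCv₀⟩ := hbig
  have hVne : V.Nonempty := ⟨v₀, hv₀V⟩
  set Q : ℝ := sSup V with hQ
  have hv₀Q : v₀ ≤ Q := le_csSup hVbdd hv₀V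
  have hCQ : C < Q := lt_of_lt_of_le hCv₀ hv₀Q
  have hQ0 : 0 < Q := hC0.trans hCQ
  -- a quadruple with value `> Q/2`
  have hhalf : Q / 2 < Q := by linarith
  obtain ⟨v, hvV, hvgt⟩ := exists_lt_of_lt_csSup hVne hhalf
  obtain ⟨s, hs, x, X, Y, Z, W, hX, hY, hZ, hW, rfl⟩ := hvV
  -- its time exceeds `T/2`
  have hsT2 : T / 2 < s := by
    by_contra hle
    push Not at hle
    have hle' : |(g s).curvatureForm (cov s) x X Y Z W| ≤ K₀ := hK₀ s ⟨hs.1, hle⟩ x X Y Z W hX hY hZ hW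
    linarith
  have hsT : s < T := lt_of_le_of_lt hs.2 ht'T
  refine ⟨s, Q, x, ⟨hs.1, hsT⟩, hQ0, ?_, ?_, ⟨X, Y, Z, W, hX, hY, hZ, hW, hvgt.le⟩⟩
  · -- `k ≤ Q s`: `Q > 4k/T`, `s > T/2`
    have h1 : 4 * (k : ℝ) < Q * T := by
      have := (div_lt_iff₀ hT).mp (hC2.trans hCQ)
      linarith
    have hk0 : (0 : ℝ) ≤ k := Nat.cast_nonneg k
    nlinarith [hQ0.le, hsT2, h1]
  · -- the bound `Q` on `[0, s] ⊆ [0, t']`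
    intro s' hs' y X' Y' Z' W' hX' hY' hZ' hW'
    exact le_csSup hVbdd ⟨s', ⟨hs'.1, hs'.2.trans hs.2⟩, y, X', Y', Z', W', hX', hY', hZ', hW', rfl⟩

end Summit.SmoothPoincare4.SmoothPoincare4.Cruxes.SubcylindricalRecognition.AncientSphereRigidity.Refuter
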